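import Literature.AnabelianGeometry.SemiGraphs.ArithLevelCofinalityOuterAction
import HarnessLib

/-!
# [SemiAnbd] Thm 5.4 (i) p. 66, producer T54-B: the residual of the hcof-free route is the `ρ`-half
# «hUρ : U_∞ ≤ ker ρ» ALONE — the `baseAct`-half of «hU-arith» is a theorem

Mochizuki, *Semi-graphs of anabelioids*, Publ. RIMS **42** (2006), §5 Def 5.1 (i) p. 62, Thm 5.4 (i)
p. 66 [cite: MochizukiSemiAnbd2006, Thm 5.4 (i) p.66].

PROOF-ONLY sequel of `ArithLevelCofinalityOuterAction.lean` (abc-iut cell, row T54-B, gap row G-w4d085-1;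
seat abc-iut-w4-d085 gen 4).  The hcof-free (AI4″) producer `map_aug_le_conj_of_levelDict_modKernel`
(ArithBranchPairAugModKernel.lean) leaves at the outer model `π₁^temp(𝒢) ⋊^out Π_A` the single residual
«hU-arith : U_∞ ≤ ker ρ ⊓ ker baseAct», `U_∞ := ⋂ⱼ aug (ker (arithAct (L j)))`.  Its `baseAct`-half is
PROVED here: an element of `E` acting trivially on ONE coset level acts trivially on the base semi-graph
(`σ_eq_one_of_arithAct_eq_one`: the arithmetic action covers `σ`, abc-iut-L3-d4's `arithAct_comp_proj`, and
the structure morphism hits every vertex/edge/branch), so `aug (ker (arithAct L)) ≤ ker baseAct` at every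
level (`map_ker_arithAct_le_ker_baseAct`) and «hU-arith» follows from the `ρ`-half
«hUρ : ∀ a ∈ U_∞, ρ a = 1» alone (`iInf_map_ker_le_of_le_ker_rho`) — "an element of `Π_A` admitting at
every finite level a lift acting trivially on that level's coset semi-graph acts on `π₁^temp(𝒢)` by an
INNER (bi-continuous) automorphism" (GAP-LEDGER G-w4d085-1: implied by normal terminality of
`π₁^temp(𝒢)` in its level completion on the `Π_A`-image; not a hypothesis of print's Thm 5.4, whose
proof p. 41/p. 66 passes through the profinite fundamental group).

No definition, no new named fact, no instance; no side taken on [IUTchIII] Cor 3.12; typed ≠ proved for the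
residual binder.
-/

namespace Literature.AnabelianGeometry.SemiGraphs


namespace SemiGraph.SubgroupPresentation

open CategoryTheory

universe u v

variable {𝔾 : SemiGraph.{u}} {Γ : Type u} [Group Γ] {E : Type v} [Group E]
  (P : SubgroupPresentation 𝔾 Γ) {Φ : E →* MulAut Γ} {σ : E →* Aut 𝔾} (hP : P.IsArithCompatible Φ σ)

/-- **An element acting trivially on a coset level acts trivially on the base semi-graph**: the
arithmetic action COVERS `σ` (abc-iut-L3-d4's `arithAct_comp_proj`) and the structure morphism hits every
vertex, edge and branch (`vMk w 1 ↦ w`, `eMk ε 1 ↦ ε`, `bMk b 1 ↦ b`).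
[cite: MochizukiSemiAnbd2006, Thm 5.4 (i) p.66] -/
theorem σ_eq_one_of_arithAct_eq_one (K : Subgroup Γ) (hK : ∀ (e : E) (x : Γ), x ∈ K → Φ e x ∈ K)
    {e : E} (he : P.arithAct hP K hK e = 1) : σ e = 1 := by
  have hcov := P.arithAct_comp_proj hP K hK e
  rw [he] at hcov
  ext : 1
  refine SemiGraph.hom_ext _ _ (funext fun w => ?_) (funext fun ε => ?_) (funext fun b => ?_)
  · exact (congrArg (fun f : P.cosetGraph K ⟶ 𝔾 => f.vertexMap (P.vMk K w 1)) hcov).symm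
  · exact (congrArg (fun f : P.cosetGraph K ⟶ 𝔾 => f.edgeMap (P.eMk K ε 1)) hcov).symm
  · exact (congrArg (fun f : P.cosetGraph K ⟶ 𝔾 => f.branchMap (P.bMk K b 1)) hcov).symm

end SemiGraph.SubgroupPresentation

namespace ProfiniteSemiGraph

open CategoryTheory Topology Filter
open Literature.AnabelianGeometry.EtaleTheta

universe w

variable {𝒢 : ProfiniteSemiGraph.{w}} (c : TemperedPiChart 𝒢)
  {PA : Type w} [Group PA] (ρ : PA →* TopOut c.G) (baseAct : PA →* Aut 𝒢.graph)
  (P : SemiGraph.SubgroupPresentation 𝒢.graph c.G)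
  (hP : P.IsArithCompatible
    (((contMulAut c.G).subtype.comp (MonoidHom.fst (contMulAut c.G) PA)).comp
      (outerSemidirectProduct ρ).subtype)
    (baseAct.comp (outerSemidirectProductSnd ρ)))

/-- **The `baseAct` half of «hU-arith» is a THEOREM**: the `Π_A`-image of the kernel of ONE level action
already lies in `ker baseAct` (an element with a lift acting trivially on one coset level acts trivially on
`𝔾`). [cite: MochizukiSemiAnbd2006, Thm 5.4 (i) p.66] -/
theorem map_ker_arithAct_le_ker_baseAct (L : Subgroup c.G)
    (hL : ∀ (e : outerSemidirectProduct ρ) (x : c.G), x ∈ L →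
      (((contMulAut c.G).subtype.comp (MonoidHom.fst (contMulAut c.G) PA)).comp
        (outerSemidirectProduct ρ).subtype) e x ∈ L) :
    ((P.arithAct hP L hL).ker).map (outerSemidirectProductSnd ρ) ≤ baseAct.ker := by
  rintro _ ⟨e, he, rfl⟩
  rw [MonoidHom.mem_ker, ← MonoidHom.comp_apply]
  exact P.σ_eq_one_of_arithAct_eq_one hP L hL ((MonoidHom.mem_ker).mp he)

/-- **Hence the residual of the hcof-free route is the `ρ`-half alone**: «hUρ : U_∞ ≤ ker ρ» — an element
of `Π_A` admitting at every finite level a lift acting trivially on that level's coset semi-graph acts on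
`π₁^temp(𝒢)` by an INNER automorphism — gives «hU-arith». [cite: MochizukiSemiAnbd2006, Thm 5.4 (i) p.66] -/
theorem iInf_map_ker_le_of_le_ker_rho {J : Type*} [Nonempty J] (L : J → Subgroup c.G)
    (hL : ∀ (j : J) (e : outerSemidirectProduct ρ) (x : c.G), x ∈ L j →
      (((contMulAut c.G).subtype.comp (MonoidHom.fst (contMulAut c.G) PA)).comp
        (outerSemidirectProduct ρ).subtype) e x ∈ L j)
    (hUρ : ∀ a : PA,
      (∀ j, a ∈ ((P.arithAct hP (L j) (hL j)).ker).map (outerSemidirectProductSnd ρ)) → a ∈ ρ.ker) :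
    ∀ a : PA, (∀ j, a ∈ ((P.arithAct hP (L j) (hL j)).ker).map (outerSemidirectProductSnd ρ)) →
      a ∈ ρ.ker ⊓ baseAct.ker := by
  intro a ha
  obtain ⟨j⟩ := ‹Nonempty J›
  exact Subgroup.mem_inf.mpr
    ⟨hUρ a ha, map_ker_arithAct_le_ker_baseAct c ρ baseAct P hP (L j) (hL j) (ha j)⟩

end ProfiniteSemiGraph

end Literature.AnabelianGeometry.SemiGraphs
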